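import Summits.BirchSwinnertonDyer.BirchSwinnertonDyer.Theorems.QuadraticBranchSignedControlPlusMainConjectureBranchSeams
import HarnessLib

/-!
# Route `QuadraticBranchSignedControl` (rung K8, cell `bsd-potss`), item `PlusKatoDivisibilityBranch`
# (stmt-BirchSwinnertonDyer-19241, the Kato half of (C1_η) as the `F`-form READING (RK⁺)): it follows
# from Kobayashi's Thm. 2.2 + Thm. 4.1 AT `η` STATED VERBATIM on the `η`-component object, granted the
# descent frame and Thm. 1.2 — i.e. "closable by formalising the prime-to-`p` descent", in the kernel

WHAT. Item 19241 `PlusKatoDivisibilityBranch` (planner g10's seam re-cut of 19114) carries the node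
(RK⁺) `QuadraticBranchPlusKatoDivisibilityAt V p` — Kobayashi 2003 Thm. 2.2 + Thm. 4.1 at the character
`η = ω^{(p−1)/2}` READ OVER `F = ℚ(√p*)` (flag `Kob03-Thm41-eta-quadratic-subtower`: the prime-to-`p`
descent `X⁺(V/F_∞) ≅ X⁺(V/ℚ_∞) ⊕ X⁺(V/K_∞)^η` is part of the reading). This file separates the two
ingredients in the kernel: GRANTED (`hdec`) the descent frame in ∀-form (for every admissible
quadratic model and `K₀ = ℚ(μ_p)`, a `Γ`-equivariant additive isomorphism
`Sel⁺(V'/F_∞) ≃ Sel⁺(V/ℚ_∞) × Sel⁺(V/K₀ℚ_∞)^η` — the SAME displayed frame as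
`plusMainConjectureBranch_of_etaPlusMainConjecture_of_decomposition` and as seat k8q-c3's
`etaTransportPlus_of_decomposition`; WANTED, not proved here) and (`h12`) Kobayashi's Thm. 1.2 over
`ℚ_∞` (NAMED fact `Kobayashi2003.thm12_signedSelmerDual_finite_torsion`), the VERBATIM statement of
Thm. 2.2 + Thm. 4.1 at `η` on cc-typer-6's `η`-component object (`hKη`: for every
`D : EtaSignedSelmerDualData V κ K₀ ℚ_[p] η γ 1`, "`X⁺(E/K_∞)^η` is a torsion `ℤ_p[[Γ]]`-module" +
"`Char(X⁺(E/K_∞)^η) ⊇ (pⁿ L_p⁺(E, η, X))`, `n = 0` if `Gal(ℚ̄/ℚ) → GL_{ℤ_p}(T)` is surjective", p. 8 —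
displayed as a hypothesis: the tree's signed-Selmer vocabulary for the `η`-object is Summits-side, so
the printed theorem cannot yet be a Literature `def`; its `η = 1` twin IS the Literature fact
`Kobayashi2003.thm41_signedCharIdeal_divisibility`) IMPLIES (RK⁺) at `(V, p)`, hence the route decl
`PlusKatoDivisibilityBranch`. So 19241 = (a theorem in print, verbatim) + (the descent frame) +
(Thm. 1.2): exactly the planner's "closable only by formalising the prime-to-`p` descent".

PROOF (the `Λ`-algebra of `QuadraticBranchSignedControlPlusMainConjectureBranchSeams` §2 with an
inclusion in place of an equality). For the binders of (RK⁺) at `(V, p)` and ARBITRARY data `D`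
(of `Sel⁺(V/ℚ_∞)` at `γ`) and `DF` (of `Sel⁺(V'/F_∞)` at `γF`): move `γ` to `γ' ∈ Gal(ℚ̄/K₀)` with
`κ γ' = κ γ`, take the existing `η`-datum `Dη` at `γ'` and the frame's `Φ`, build the product datum
on `D.X × Dη.X`; `DF.X ≃ₗ[Λ] D.X × Dη.X` (uniqueness), `Char DF = Char D · Char Dη`
(multiplicativity; torsion of `D.X` by Thm. 1.2, of `Dη.X` by `hKη`), and `pⁿ Lη ∈ Char Dη` gives
`(pⁿ) · Char D · (Lη) = Char D · ((pⁿ)(Lη)) ⊆ Char D · Char Dη = Char DF` (`Ideal.mul_mono_right`);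
`n = 0` on the surjective rows likewise.

HONEST FRAMING (cell `bsd-potss`, run/shared/lean/pub/bsd-potss/; FULL-BSD rank ≤ 1 programme): TOOL
THEOREMS ONLY — no definition, no named fact minted, no `sorry`, axioms standard. CONDITIONAL on the
displayed frame `hdec`, the displayed verbatim reading `hKη` and the named fact `h12`; the item /
route are NOT closed; nothing is booked; `BSD(W, p)` is claimed for no pair; this is not "finishing
BSD". Seat `bsd-potss-k8q-c2` (prover), g0; `--supports stmt-BirchSwinnertonDyer-19241` (helper).

References: [Kobayashi2003] Thm. 1.2 (p. 2), Def. 2.1 + Thm. 2.2 (p. 5), §3 (p. 5), Thm. 4.1 (p. 8);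
[Kato2004Asterisque] Thm. 12.5; [GreenbergLNM1716] §1 (p. 60), §3; [Washington1997] §13.2.
-/

set_option autoImplicit false
set_option linter.dupNamespace false

noncomputable section

open scoped Classical

open CongruenceSubgroup Field WeierstrassCurve
open Literature.NumberTheory.EllipticCurves
open Literature.NumberTheory.EllipticCurves.ModularForms
open Literature.NumberTheory.EllipticCurves.Kobayashi2003 hiding towerSignedSelmerInftyEta towerTopSubgroup EtaSignedSelmerDualData
  IsQuadraticBranchPlusLFunction
open Literature.NumberTheory.GaloisRepresentations
open Summit.BirchSwinnertonDyer.Rank1Residual.Additive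
open Summit.BirchSwinnertonDyer.Rank1Residual.Additive.SignedTwist
open Summit.BirchSwinnertonDyer.BirchSwinnertonDyer.Theses.QuadraticBranchSignedControl

namespace Summit.BirchSwinnertonDyer.BirchSwinnertonDyer.Theorems

/-- **(RK⁺) AT A PAIR from Kobayashi's Thm. 2.2 + 4.1 at `η` stated VERBATIM on the `η`-component
object, granted the descent frame and Thm. 1.2 — abstract cyclotomic model `K₀`.** For `V/ℚ`, `p`, a
cyclotomic model `K₀` (`IsCyclotomicExtension {p} ℚ K₀`, `Gal(ℚ̄/K₀)` normal) and a character `ηq`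
(MEANT: the quadratic character of `Gal(K₀/ℚ)`): IF (`h12`) Thm. 1.2 (NAMED fact), (`hdec`) the
∀-form descent frame at `(V, p, K₀, ηq)` (WANTED; not proved here), and (`hKη`) for every generator
`γ ∈ Gal(ℚ̄/K₀)` matching the variable and every `D : EtaSignedSelmerDualData V κ K₀ ℚ_[p] ηq γ 1`:
finitely generated, torsion, `pⁿ · Lη ∈ Char` for some `n`, and `Lη ∈ Char` when `ρ_{V,p^∞}` is onto
(Thm. 2.2 + Thm. 4.1 first display and last sentence at `η`, p. 8, VERBATIM on the `η`-object;
displayed), THEN `QuadraticBranchPlusKatoDivisibilityAt V p`. Proof: module docstring. CONDITIONAL;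
closes nothing. [cite: Kobayashi2003, Thm. 1.2 (p. 2), Thm. 2.2 (p. 5), Thm. 4.1 (p. 8), §3 (p. 5)]
[cite: GreenbergLNM1716, §1 (p. 60) and §3 (descent in prime-to-p extensions; reading)]
[cite: Washington1997, §13.2 (characteristic ideals over Λ)] -/
theorem quadraticBranchPlusKatoDivisibilityAt_of_etaKatoDivisibility_of_decomposition
    {V : WeierstrassCurve ℚ} [V.IsElliptic] [V.IsGloballyMinimal] {p : ℕ} [Fact p.Prime]
    (h12 : thm12_signedSelmerDual_finite_torsion)
    (K₀ : Type) [Field K₀] [NumberField K₀] [IsCyclotomicExtension {p} ℚ K₀]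
    [(galRange (K := ℚ) K₀).Normal] (ηq : absoluteGaloisGroup ℚ →* ℤˣ)
    (hdec : ∀ (κ : ZpExtension ℚ p) (γ : absoluteGaloisGroup ℚ),
        κ.IsCyclotomic → κ.IsTopGenerator γ → γ ∈ galRange (K := ℚ) K₀ →
        IsCyclotomicVariable p γ →
      ∀ (F : Type) [Field F] [NumberField F] (V' : WeierstrassCurve F) [V'.IsElliptic]
        (κF : ZpExtension F p) (γF : absoluteGaloisGroup F),
        Module.finrank ℚ F = 2 → (∃ θ : F, θ ^ 2 = algebraMap ℚ F ((-1) ^ (p / 2) * p)) →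
        (∃ C : VariableChange F, C • V.baseChange F = V') →
        κF.IsCyclotomic → κF.IsTopGenerator γF →
        (∃ ζ : ℤ_[p]ˣ, IsOfFinOrder ζ ∧
          ((GaloisRep.cyclotomicCharacter F p γF * ζ : ℤ_[p]ˣ) : ℤ_[p]) =
            (cyclotomicGenerator p : ℤ_[p])) →
      ∃ Φ : signedSelmerInfty V' κF 1 ≃+
          signedSelmerInfty V κ 1 × towerSignedSelmerInftyEta V κ K₀ ℚ_[p] ηq 1,
        ∀ s : signedSelmerInfty V' κF 1,
          ((Φ ⟨V'.conjH1 p κF.kerSubgroup γF s,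
              conjH1_mem_signedSelmerInfty V' κF 1 γF s.2⟩).1 : V.subgroupH1 p κ.kerSubgroup) =
            V.conjH1 p κ.kerSubgroup γ (Φ s).1 ∧
          ((Φ ⟨V'.conjH1 p κF.kerSubgroup γF s,
              conjH1_mem_signedSelmerInfty V' κF 1 γF s.2⟩).2 :
              V.subgroupH1 p (towerTopSubgroup κ K₀)) =
            V.conjH1 p (towerTopSubgroup κ K₀) γ (Φ s).2)
    (hKη : ∀ {N : ℕ} [NeZero N] {f : CuspForm (Gamma0 N) 2},
        p ≠ 2 → V.HasGoodReductionAtPrime p → V.frobeniusTrace p = 0 → IsNewformOf V f →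
      ∀ (ϖ : ℚ), (if Even (p / 2) then (ϖ : ℝ) * V.realPeriodRat = plusPeriod f
          else (ϖ : ℝ) * V.imaginaryPeriodRat = minusPeriod f) →
      ∀ (Lη : IwasawaAlgebra p), IsQuadraticBranchPlusLFunction f p ϖ Lη →
      ∀ (κ : ZpExtension ℚ p) (γ : absoluteGaloisGroup ℚ),
        κ.IsCyclotomic → κ.IsTopGenerator γ → γ ∈ galRange (K := ℚ) K₀ →
        IsCyclotomicVariable p γ →
      ∀ (D : EtaSignedSelmerDualData V κ K₀ ℚ_[p] ηq γ 1),
        Module.Finite (IwasawaAlgebra p) D.X ∧ Module.IsTorsion (IwasawaAlgebra p) D.X ∧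
          (∃ n : ℕ, (p : IwasawaAlgebra p) ^ n * Lη ∈ D.charIdeal) ∧
          ((∀ m : ℕ, V.HasSurjectiveModNGaloisRep (p ^ m : ℕ)) → Lη ∈ D.charIdeal)) :
    QuadraticBranchPlusKatoDivisibilityAt V p := by
  intro F _ _ V' _ κ γ κF γF N _ f hp2 hgood hap hF hθ hC hκ hγ hγc hκF hγF hζ hf ϖ hϖ Lη hL D DF
  -- move `γ` inside `Gal(ℚ̄/K₀)` keeping `κ γ`
  have hκ₀ := kappa_surjOn_galRange_cyclotomic κ K₀
  obtain ⟨γ', hγ'K, hγ'κ⟩ := hκ₀ (κ γ)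
  have hγγ' : γ⁻¹ * γ' ∈ κ.kerSubgroup := by
    rw [ZpExtension.mem_kerSubgroup, map_mul, map_inv, hγ'κ, inv_mul_cancel]
  have hγ' : κ.IsTopGenerator γ' := by rw [ZpExtension.IsTopGenerator, hγ'κ]; exact hγ
  have hγ'c : IsCyclotomicVariable p γ' := isCyclotomicVariable_of_inv_mul_mem_ker hκ hγγ' hγc
  -- `conj_{γ'} = conj_γ` on `H¹(ℚ_∞, V[p^∞])`
  have hconj : ∀ s : V.subgroupH1 p κ.kerSubgroup,
      V.conjH1 p κ.kerSubgroup γ' s = V.conjH1 p κ.kerSubgroup γ s := by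
    intro s
    have hmul := V.conjH1_mul_holds p κ.kerSubgroup γ (γ⁻¹ * γ')
    rw [mul_inv_cancel_left] at hmul
    rw [hmul, AddMonoidHom.comp_apply, V.conjH1_of_mem_holds p κ.kerSubgroup hγγ',
      AddMonoidHom.id_apply]
  -- the decomposition frame at `(κ, γ', F, V', κF, γF)` and an `η`-datum at `γ'`
  obtain ⟨Φ, hΦ⟩ := hdec κ γ' hκ hγ' hγ'K hγ'c F V' κF γF hF hθ hC hκF hγF hζ
  obtain ⟨Dη⟩ := nonempty_etaSignedSelmerDualData V κ K₀ ℚ_[p] ηq 1 hκ₀ hγ' hγ'K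
  -- the two inputs
  obtain ⟨hDfin, hDtor⟩ := h12 V p hp2 hgood hap κ γ hκ hγ 1 D
  obtain ⟨hηfin, hηtor, ⟨n, hn⟩, hint⟩ :=
    hKη hp2 hgood hap hf ϖ hϖ Lη hL κ γ' hκ hγ' hγ'K hγ'c Dη
  -- the character group of the direct sum and the product datum at `γF`
  let π₀ : signedSelmerInfty V' κF 1 →+ signedSelmerInfty V κ 1 :=
    (AddMonoidHom.fst _ _).comp Φ.toAddMonoidHom
  let π₁ : signedSelmerInfty V' κF 1 →+ towerSignedSelmerInftyEta V κ K₀ ℚ_[p] ηq 1 :=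
    (AddMonoidHom.snd _ _).comp Φ.toAddMonoidHom
  let T : D.X × Dη.X →+ (signedSelmerInfty V' κF 1 →+ AddCircle (1 : ℚ)) :=
    AddMonoidHom.mk' (fun x => (D.toDual x.1).comp π₀ + (Dη.toDual x.2).comp π₁) (by
      intro x y
      simp only [Prod.fst_add, Prod.snd_add, map_add, AddMonoidHom.add_comp]
      abel)
  have hT : ∀ (x : D.X × Dη.X) (s : signedSelmerInfty V' κF 1),
      T x s = D.toDual x.1 (Φ s).1 + Dη.toDual x.2 (Φ s).2 := fun x s => rfl
  have hTbij : Function.Bijective T :=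
    bijective_dualOfProd Φ D.toDual Dη.toDual D.bijective Dη.bijective
  let DF' : SignedSelmerDualData V' κF γF 1 :=
    { X := D.X × Dη.X
      conj_mem := fun s hs => conjH1_mem_signedSelmerInfty V' κF 1 γF hs
      toDual := T
      bijective := hTbij
      toDual_T_smul := by
        intro x s
        have h0 : (Φ ⟨V'.conjH1 p κF.kerSubgroup γF s,
            conjH1_mem_signedSelmerInfty V' κF 1 γF s.2⟩).1 =
            ⟨V.conjH1 p κ.kerSubgroup γ (Φ s).1, D.conj_mem _ (Φ s).1.2⟩ :=
          Subtype.ext (by rw [(hΦ s).1, hconj])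
        have h1 : (Φ ⟨V'.conjH1 p κF.kerSubgroup γF s,
            conjH1_mem_signedSelmerInfty V' κF 1 γF s.2⟩).2 =
            ⟨V.conjH1 p (towerTopSubgroup κ K₀) γ' (Φ s).2, Dη.conj_mem _ (Φ s).2.2⟩ :=
          Subtype.ext (hΦ s).2
        rw [hT, hT, hT, Prod.smul_fst, Prod.smul_snd, D.toDual_T_smul, Dη.toDual_T_smul, h0, h1]
        abel
      toDual_C_smul := by
        intro c x s k hk
        have hk' : (p ^ k) • Φ s = 0 := by rw [← map_nsmul, hk, map_zero]
        have hk0 : (p ^ k) • (Φ s).1 = 0 := by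
          have h := congrArg Prod.fst hk'
          rwa [Prod.smul_fst, Prod.fst_zero] at h
        have hk1 : (p ^ k) • (Φ s).2 = 0 := by
          have h := congrArg Prod.snd hk'
          rwa [Prod.smul_snd, Prod.snd_zero] at h
        rw [hT, hT, Prod.smul_fst, Prod.smul_snd, D.toDual_C_smul c x.1 _ k hk0,
          Dη.toDual_C_smul c x.2 _ k hk1, smul_add] }
  -- the product is finitely generated torsion with `Char = Char D.X · Char Dη.X`
  haveI : Module.Finite (IwasawaAlgebra p) D.X := hDfin
  haveI : Module.Finite (IwasawaAlgebra p) Dη.X := hηfin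
  have hPfin : Module.Finite (IwasawaAlgebra p) (D.X × Dη.X) := inferInstance
  have hPtor : Module.IsTorsion (IwasawaAlgebra p) (D.X × Dη.X) :=
    isTorsion_prod_of_isTorsion hDtor hηtor
  have hPchar : Module.charIdeal (IwasawaAlgebra p) (D.X × Dη.X) =
      Module.charIdeal (IwasawaAlgebra p) D.X * Module.charIdeal (IwasawaAlgebra p) Dη.X :=
    charIdeal_mul_of_shortExact_holds p (D.X × Dη.X) hPtor
      (LinearMap.inl (IwasawaAlgebra p) D.X Dη.X) (LinearMap.snd (IwasawaAlgebra p) D.X Dη.X)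
      LinearMap.inl_injective LinearMap.snd_surjective .inl_snd
  -- transport to the GIVEN datum `DF`
  obtain ⟨e, -⟩ := SignedSelmerDualData.exists_linearEquiv DF DF'
  have hfinF : Module.Finite (IwasawaAlgebra p) DF.X :=
    (SignedSelmerDualData.moduleFinite_iff DF DF').mpr hPfin
  have htorF : Module.IsTorsion (IwasawaAlgebra p) DF.X :=
    (SignedSelmerDualData.isTorsion_iff DF DF').mpr hPtor
  have hcharF : DF.charIdeal = D.charIdeal * Dη.charIdeal := by
    change Module.charIdeal (IwasawaAlgebra p) DF.X =
      Module.charIdeal (IwasawaAlgebra p) D.X * Module.charIdeal (IwasawaAlgebra p) Dη.X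
    rw [Module.charIdeal_eq_of_linearEquiv e]
    exact hPchar
  refine ⟨hfinF, htorF, ⟨n, ?_⟩, fun hsurj => ?_⟩
  · -- `(pⁿ) · Char D · (Lη) = Char D · ((pⁿ)(Lη)) ⊆ Char D · Char Dη = Char DF`
    rw [hcharF, mul_left_comm, Ideal.span_singleton_mul_span_singleton]
    exact Ideal.mul_mono_right ((Ideal.span_singleton_le_iff_mem _).mpr hn)
  · rw [hcharF]
    exact Ideal.mul_mono_right ((Ideal.span_singleton_le_iff_mem _).mpr (hint hsurj))

/-- **Item 19241 `PlusKatoDivisibilityBranch` FROM Kobayashi's Thm. 2.2 + 4.1 at `η` VERBATIM on the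
`η`-component object, granted the descent frame and Thm. 1.2** (route-level form; the conclusion is
the route decl literally). Hypotheses, all displayed: `h12` (NAMED fact, Thm. 1.2); `hdec` (the
∀-form descent frame — for every `p ≥ 5`, cyclotomic `K₀`, quadratic `ηq`, good `a_p = 0` curve `V`,
generator `γ ∈ Gal(ℚ̄/K₀)` matching the variable, and every admissible quadratic model: a
`Γ`-equivariant `Φ : Sel⁺(V'/F_∞) ≃ Sel⁺(V/ℚ_∞) × Sel⁺(V/K₀ℚ_∞)^η`; WANTED; not proved here); `hKη`
(Thm. 2.2 + Thm. 4.1 first display and last sentence at `η`, p. 8, VERBATIM on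
`EtaSignedSelmerDualData V κ K₀ ℚ_[p] ηq γ 1` — the `η`-component twin of the Literature fact
`Kobayashi2003.thm41_signedCharIdeal_divisibility`; displayed because the `η`-object's vocabulary is
Summits-side). `K₀ := ℚ(ζ_p)`, `η` from `exists_theta_eta_cyclotomicField`. So item 19241 reduces to
(verbatim print) + (descent frame) + (Thm. 1.2). CONDITIONAL; closes nothing.
[cite: Kobayashi2003, Thm. 1.2 (p. 2), Thm. 2.2 (p. 5), Thm. 4.1 (p. 8), §3 (p. 5)]
[cite: GreenbergLNM1716, §1 (p. 60) and §3 (descent in prime-to-p extensions; reading)] -/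
theorem plusKatoDivisibilityBranch_of_etaKatoDivisibility_of_decomposition
    (h12 : thm12_signedSelmerDual_finite_torsion)
    (hdec : ∀ (p : ℕ) [Fact p.Prime], 5 ≤ p →
      ∀ (K₀ : Type) [Field K₀] [NumberField K₀] [IsCyclotomicExtension {p} ℚ K₀]
        [(galRange (K := ℚ) K₀).Normal] (ηq : absoluteGaloisGroup ℚ →* ℤˣ),
        (∀ σ ∈ galRange (K := ℚ) K₀, ηq σ = 1) → ηq ≠ 1 →
      ∀ (V : WeierstrassCurve ℚ) [V.IsElliptic] [V.IsGloballyMinimal],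
        V.HasGoodReductionAtPrime p → V.frobeniusTrace p = 0 →
      ∀ (κ : ZpExtension ℚ p) (γ : absoluteGaloisGroup ℚ),
        κ.IsCyclotomic → κ.IsTopGenerator γ → γ ∈ galRange (K := ℚ) K₀ →
        IsCyclotomicVariable p γ →
      ∀ (F : Type) [Field F] [NumberField F] (V' : WeierstrassCurve F) [V'.IsElliptic]
        (κF : ZpExtension F p) (γF : absoluteGaloisGroup F),
        Module.finrank ℚ F = 2 → (∃ θ : F, θ ^ 2 = algebraMap ℚ F ((-1) ^ (p / 2) * p)) →
        (∃ C : VariableChange F, C • V.baseChange F = V') →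
        κF.IsCyclotomic → κF.IsTopGenerator γF →
        (∃ ζ : ℤ_[p]ˣ, IsOfFinOrder ζ ∧
          ((GaloisRep.cyclotomicCharacter F p γF * ζ : ℤ_[p]ˣ) : ℤ_[p]) =
            (cyclotomicGenerator p : ℤ_[p])) →
      ∃ Φ : signedSelmerInfty V' κF 1 ≃+
          signedSelmerInfty V κ 1 × towerSignedSelmerInftyEta V κ K₀ ℚ_[p] ηq 1,
        ∀ s : signedSelmerInfty V' κF 1,
          ((Φ ⟨V'.conjH1 p κF.kerSubgroup γF s,
              conjH1_mem_signedSelmerInfty V' κF 1 γF s.2⟩).1 : V.subgroupH1 p κ.kerSubgroup) =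
            V.conjH1 p κ.kerSubgroup γ (Φ s).1 ∧
          ((Φ ⟨V'.conjH1 p κF.kerSubgroup γF s,
              conjH1_mem_signedSelmerInfty V' κF 1 γF s.2⟩).2 :
              V.subgroupH1 p (towerTopSubgroup κ K₀)) =
            V.conjH1 p (towerTopSubgroup κ K₀) γ (Φ s).2)
    (hKη : ∀ (p : ℕ) [Fact p.Prime], 5 ≤ p →
      ∀ (K₀ : Type) [Field K₀] [NumberField K₀] [IsCyclotomicExtension {p} ℚ K₀]
        [(galRange (K := ℚ) K₀).Normal] (ηq : absoluteGaloisGroup ℚ →* ℤˣ),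
        (∀ σ ∈ galRange (K := ℚ) K₀, ηq σ = 1) → ηq ≠ 1 →
      ∀ (V : WeierstrassCurve ℚ) [V.IsElliptic] [V.IsGloballyMinimal] {N : ℕ} [NeZero N]
        {f : CuspForm (Gamma0 N) 2},
        p ≠ 2 → V.HasGoodReductionAtPrime p → V.frobeniusTrace p = 0 → IsNewformOf V f →
      ∀ (ϖ : ℚ), (if Even (p / 2) then (ϖ : ℝ) * V.realPeriodRat = plusPeriod f
          else (ϖ : ℝ) * V.imaginaryPeriodRat = minusPeriod f) →
      ∀ (Lη : IwasawaAlgebra p), IsQuadraticBranchPlusLFunction f p ϖ Lη →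
      ∀ (κ : ZpExtension ℚ p) (γ : absoluteGaloisGroup ℚ),
        κ.IsCyclotomic → κ.IsTopGenerator γ → γ ∈ galRange (K := ℚ) K₀ →
        IsCyclotomicVariable p γ →
      ∀ (D : EtaSignedSelmerDualData V κ K₀ ℚ_[p] ηq γ 1),
        Module.Finite (IwasawaAlgebra p) D.X ∧ Module.IsTorsion (IwasawaAlgebra p) D.X ∧
          (∃ n : ℕ, (p : IwasawaAlgebra p) ^ n * Lη ∈ D.charIdeal) ∧
          ((∀ m : ℕ, V.HasSurjectiveModNGaloisRep (p ^ m : ℕ)) → Lη ∈ D.charIdeal)) :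
    PlusKatoDivisibilityBranch := by
  intro V _ _ p _ hp5 hgood hap
  have hp2 : p ≠ 2 := by omega
  haveI : NeZero p := ⟨(Fact.out : p.Prime).ne_zero⟩
  haveI : IsCyclotomicExtension {p} ℚ (CyclotomicField p ℚ) :=
    CyclotomicField.isCyclotomicExtension p ℚ
  haveI : (galRange (K := ℚ) (CyclotomicField p ℚ)).Normal := normal_galRange_cyclotomic p _
  obtain ⟨θ, ηq, -, -, -, hηK, hη1⟩ := exists_theta_eta_cyclotomicField p hp2
  exact quadraticBranchPlusKatoDivisibilityAt_of_etaKatoDivisibility_of_decomposition h12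
    (CyclotomicField p ℚ) ηq
    (fun κ γ hκ hγ hγK hγc F _ _ V' _ κF γF hF hθ hC hκF hγF hζ =>
      hdec p hp5 (CyclotomicField p ℚ) ηq hηK hη1 V hgood hap κ γ hκ hγ hγK hγc F V' κF γF hF hθ hC
        hκF hγF hζ)
    (fun hp2' hgood' hap' hf ϖ hϖ Lη hL κ γ hκ hγ hγK hγc Dη =>
      hKη p hp5 (CyclotomicField p ℚ) ηq hηK hη1 V hp2' hgood' hap' hf ϖ hϖ Lη hL κ γ hκ hγ hγK
        hγc Dη)

end Summit.BirchSwinnertonDyer.BirchSwinnertonDyer.Theorems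

end
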